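import Literature.MathematicalPhysics.QuantumFieldTheory.Balaban1983to89.B7Prop5Cplx
import Literature.MathematicalPhysics.QuantumFieldTheory.Balaban1983to89.B7Prop7Ins
import Literature.MathematicalPhysics.QuantumFieldTheory.Balaban1983to89.B7Prop5FlatOperator
import Mathlib.Analysis.Calculus.FDeriv.Analytic

/-!
# `Balaban1983to89.B7Prop5CplxAnalytic` — T. Bałaban, *Averaging operations for lattice gauge theories*, Commun. Math. Phys. **98**
(1985) 17–51 [Balaban1985Averaging]: **PROPOSITION 5 EXTENDED «TO INCLUDE ANALYTICITY … STATEMENTS»** (p. 43) — file 6 (sequel of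
`B7Prop5Cplx`): on the printed polydisc of the bond variables `(A′_b)_{b∈S′}`, `(A_b)_{b∈S}`, the functional derivative
`(δ/δA_b)Q_k(U′U₀, ηA, c)` IS the Fréchet partial derivative of the jointly analytic `(A′, A) ↦ Q_k(e^{A′}U₀, A)(c)`, hence an
ANALYTIC function of `(A′, A)`, and its bound (156) holds UNIFORMLY on the polydisc

statement-level skeleton of published theorems with citation tags; proofs where landed; nothing here is a claim about the Yang–Mills mass gap

PDF held: `paper:balaban1985-cmp98-averaging` (journal page = PDF page + 16); pp. 42–43 [PDF 26–27] read from the materialised text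
layer `~/.lit/texts/paper-balaban1985-cmp98-averaging/p0026.txt`, `p0027.txt`.

CITATION HEADER / WHAT IS REPRODUCED.  SKELETON row **B7.Prop7** (cell `lit-balaban`, HOME `run/shared/lean/pub/lit-balaban/`, seat
p06 gen 4 = unit `lit-balaban-p06`; B7 owner r04, referee ref-4).  p. 43, verbatim: *"Proposition 7. For U₀ satisfying (52) and U′ =
e^{iηA′}, |A′| < α₁, α₀, α₁ sufficiently small, the function Q_k(U′U₀, ηA) is analytic in complex variables A′, A, and Proposition 4
holds uniformly in A′. Similarly, Proposition 5 may be extended to include analyticity and uniformity statements. The formulations are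
obvious."*  The UNIFORMITY statement is `B7Prop5Cplx` (file 5: (147)/(156)/(157) at `U′U₀` per bond with constants independent of
`U′`).  THE ANALYTICITY STATEMENT, typed and proved here: r04's `B7Prop7Ins.prop7_analyticOnNhd_ins` gives the joint analyticity of
`F_c : (a′, a) ↦ Q_j(e^{ins_{S′} a′}U₀, ins_S a)(c)` on the open polydisc `P = {∀ b, ‖a′_b‖ < ρ′} × {∀ b, ‖a_b‖ < ρ}`; the Fréchet
derivative of an analytic map into the complete algebra `𝔸` is analytic (Mathlib `AnalyticOnNhd.fderiv`), so every partial
derivative `(a′, a) ↦ D F_c(a′, a)·(0, X·δ_s)` is analytic on `P` (§1); and that partial derivative IS the single-bond differential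
(137) `dC_j(ins a; X·δ_s)(c) + LʲηQ_j(e^{ins a′}U₀)(X·δ_s)(c)` of file 5 (uniqueness of the derivative along the inserted complex line
`ins(a + tX·δ_s) = ins a + t·bump_s X`, `B7Prop5FlatOperator.insCfg_line`) (§2) — so the functional derivative (156) of
`Q_j(U′U₀, ηA)` is an analytic function of `(A′, A)` on `P`, bounded there by `((1 + ϑ(ρ′)Lʲ/Lᵏ)Lʲ + C₃(Lʲ)²ρ)·L^{−jd}·‖X‖` (§3).

DICTIONARY / HYPOTHESES: as in `B7Prop7Ins` §2 (polydisc radii `ρ′`, `ρ` in the `b′`/`b` slots of `B7Prop7Levels`) plus the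
Prop.-5 smallness of `B7Prop5Cplx` at the radii: `16Lᵏρ < c₃`, `epsCplx d L ρ′ k ≤ 1/16`, `d·(epsCplx … ρ′ k + tauCplx … ρ′ k) ≤ 1/16`,
`d·C3Cplx·Lᵏρ ≤ 1`.

WHAT THIS FILE PROVES (kernel, 0 sorry, standard axioms; theorems only): `fderiv_logCovIter_cplx_analyticOnNhd`,
`fderiv_apply_logCovIter_cplx_analyticOnNhd` (§1), **`fderiv_logCovIter_cplx_single_eq`** (§2), **`prop5_cplx_156_analyticOnNhd`**,
**`prop5_cplx_156_uniform_on_polydisc`** (§3).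
HONEST DIVERGENCES (located): as in files 1–5; the polydisc is print's domain «|A′| < α₁», «|A| < α₁» in the variables of two
arbitrary finite bond sets `S′`, `S` (global sup bounds on `ℤᵈ` otherwise), radii subject to the displayed smallness.
-/

noncomputable section

open scoped BigOperators
open NormedSpace Finset Metric Set

namespace Literature.MathematicalPhysics.QuantumFieldTheory.Balaban1983to89.B7Prop5CplxAnalytic

open B7Prop1Explicit B7Prop1Local B7Prop2Explicit B7Prop3Flat B7Prop4Flat B7Prop5Flat B7Eq92Concrete B7Prop3GeneralLinear
  B7Prop4GeneralLevels B7Prop5GeneralInduction B7Prop5CplxLevels B7Prop5Cplx B7Prop7Levels B7Prop7Ins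
open B7Prop5FlatOperator (insCfg_line)

-- `Site` alone would resolve to the torus sites of `Setup.lean`; re-export the `ℤ^d` sites of `B7Prop1Explicit`.
export B7Prop1Explicit (Site)

variable {d : ℕ}
variable {𝔸 : Type*} [NormedRing 𝔸] [NormedAlgebra ℂ 𝔸] [CompleteSpace 𝔸] [NormOneClass 𝔸]

section Polydisc

variable (S' S : Finset (Site d × Fin d)) (L : ℕ) (hL : 2 ≤ L) {G : Subgroup 𝔸ˣ} (hG : AvgClosed d L G) (k : ℕ)
  (U₀ : Site d → Fin d → 𝔸ˣ) (hU₀ : ∀ x κ, U₀ x κ ∈ G) {α₀ : ℝ} (hα : 0 < α₀)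
  (hα3 : C0 d * α₀ ≤ 1 / 3) (hα8 : 8 * α₀ ≤ c2' d L) (h52 : pdev U₀ < α₀ * (((L : ℝ) ^ k)⁻¹) ^ 2)
  {ρ' ρ : ℝ} (hρ' : 0 < ρ') (hρ : 0 < ρ)
  (hsmall' : Real.exp (4 * (800 * ((d : ℝ) + 1) ^ 2 * ((d : ℝ) + 4)) * α₀)
    * (1 + 8 * (131072 * ((d : ℝ) + 1) ^ 2) * ((L : ℝ) ^ k * ρ')) ≤ 2)
  (hc₃' : 2 * ((L : ℝ) ^ k * ρ') ≤ c3 d L) (hρ'1 : 409600 * ((d : ℝ) + 1) ^ 2 * ((L : ℝ) ^ k * ρ') ≤ 1)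
  (hsmall : Real.exp (4480 * ((d : ℝ) + 1) ^ 2 * ((d : ℝ) + 4) * α₀ + 240000 * ((d : ℝ) + 1) ^ 3 * ((L : ℝ) ^ k * ρ'))
    * (1 + 8 * (2097152 * ((d : ℝ) + 1) ^ 2) * ((L : ℝ) ^ k * ρ)) ≤ 2)
  (hc₃ : 16 * ((L : ℝ) ^ k * ρ) < c3 d L)
  (hE : epsCplx d L ρ' k ≤ 1 / 16) (hdX : (d : ℝ) * (epsCplx d L ρ' k + tauCplx d L α₀ k ρ' k) ≤ 1 / 16)
  (hβ : (d : ℝ) * C3Cplx d L * ((L : ℝ) ^ k * ρ) ≤ 1)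

/-! ## §1 The Fréchet derivative of `(A′, A) ↦ Q_j(e^{A′}U₀, A)(c)` is analytic on the polydisc -/

include hL hG hU₀ hα hα3 hα8 h52 hρ' hρ hsmall' hc₃' hρ'1 hsmall hc₃ in
/-- **the Fréchet derivative of the jointly analytic `(a′, a) ↦ Q_j(e^{ins a′}U₀, ins a)(c)` is analytic on the polydisc** (Prop. 7's
joint analyticity `B7Prop7Ins.prop7_analyticOnNhd_ins` + Mathlib: derivatives of analytic maps into a complete space are analytic).
[cite: Balaban1985Averaging, Proposition 7 p.43] -/
theorem fderiv_logCovIter_cplx_analyticOnNhd {j : ℕ} (hj : j ≤ k) (z : Site d) (κ : Fin d) :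
    AnalyticOnNhd ℂ
      (fderiv ℂ (fun t : (S' → 𝔸) × (S → 𝔸) => logCovIter L (expCfg (insCfg S' t.1) * U₀) (insCfg S t.2) j z κ))
      {t | (∀ s, ‖t.1 s‖ < ρ') ∧ ∀ s, ‖t.2 s‖ < ρ} := by
  have hLkρ : 0 ≤ (L : ℝ) ^ k * ρ := by positivity
  have hc₃4 : 2 * ((L : ℝ) ^ k * ρ) ≤ c3 d L / 4 := by linarith
  exact (prop7_analyticOnNhd_ins S' S L hL hG k U₀ hU₀ hα hα3 hα8 h52 hρ' hρ hsmall' hc₃' hρ'1 hsmall hc₃4 j hj z κ).fderiv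

include hL hG hU₀ hα hα3 hα8 h52 hρ' hρ hsmall' hc₃' hρ'1 hsmall hc₃ in
/-- … hence every directional derivative `(a′, a) ↦ D[Q_j(e^{ins ·}U₀, ins ·)(c)](a′, a)·δ` is analytic on the polydisc.
[cite: Balaban1985Averaging, Proposition 7 p.43] -/
theorem fderiv_apply_logCovIter_cplx_analyticOnNhd {j : ℕ} (hj : j ≤ k) (z : Site d) (κ : Fin d) (δ : (S' → 𝔸) × (S → 𝔸)) :
    AnalyticOnNhd ℂ
      (fun t : (S' → 𝔸) × (S → 𝔸) =>
        fderiv ℂ (fun t : (S' → 𝔸) × (S → 𝔸) => logCovIter L (expCfg (insCfg S' t.1) * U₀) (insCfg S t.2) j z κ) t δ)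
      {t | (∀ s, ‖t.1 s‖ < ρ') ∧ ∀ s, ‖t.2 s‖ < ρ} :=
  (ContinuousLinearMap.apply ℂ 𝔸 δ).comp_analyticOnNhd
    (fderiv_logCovIter_cplx_analyticOnNhd S' S L hL hG k U₀ hU₀ hα hα3 hα8 h52 hρ' hρ hsmall' hc₃' hρ'1 hsmall hc₃ hj z κ)

/-! ## §2 The partial derivative in `A_s` IS the single-bond differential (137) of file 5 -/

include hL hG hU₀ hα hα3 hα8 h52 hρ' hρ hsmall' hc₃' hρ'1 hsmall hc₃ hE hdX hβ in
/-- **`∂_{A_s}Q_j(e^{A′}U₀, A)(c)·X = dC_j(A; X·δ_s)(c) + LʲηQ_j(e^{A′}U₀)(X·δ_s)(c)`** on the polydisc: the Fréchet derivative of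
`(a′, a) ↦ Q_j(e^{ins a′}U₀, ins a)(c)` at `t = (a′, a)` applied to `(0, X·δ_s)` is file 5's single-bond line derivative at the
background `e^{ins a′}U₀`, the field `ins a` and the direction `bump_s X` (uniqueness of the derivative along the inserted complex line
`ins(a + τX·δ_s) = ins a + τ·bump_s X`). [cite: Balaban1985Averaging, (137)–(138) p.39, Prop. 5 (156) p.42, Proposition 7 p.43] -/
theorem fderiv_logCovIter_cplx_single_eq {j : ℕ} (hj : j ≤ k) (z : Site d) (κ : Fin d) (t : (S' → 𝔸) × (S → 𝔸))
    (ht : (∀ s, ‖t.1 s‖ < ρ') ∧ ∀ s, ‖t.2 s‖ < ρ) (s : S) (X : 𝔸) :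
    fderiv ℂ (fun t : (S' → 𝔸) × (S → 𝔸) => logCovIter L (expCfg (insCfg S' t.1) * U₀) (insCfg S t.2) j z κ) t
        ((0 : S' → 𝔸), (Pi.single s X : S → 𝔸))
      = dCov L (expCfg (insCfg S' t.1) * U₀) (insCfg S t.2) (bump s.1.1 s.1.2 X) j z κ
        + linCovIter L (expCfg (insCfg S' t.1) * U₀) (bump s.1.1 s.1.2 X) j z κ := by
  set F : (S' → 𝔸) × (S → 𝔸) → 𝔸 :=
    fun t => logCovIter L (expCfg (insCfg S' t.1) * U₀) (insCfg S t.2) j z κ with hF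
  have hLkρ : 0 ≤ (L : ℝ) ^ k * ρ := by positivity
  have hc₃4 : 2 * ((L : ℝ) ^ k * ρ) ≤ c3 d L / 4 := by linarith
  have hFa : AnalyticAt ℂ F t :=
    prop7_analyticOnNhd_ins S' S L hL hG k U₀ hU₀ hα hα3 hα8 h52 hρ' hρ hsmall' hc₃' hρ'1 hsmall hc₃4 j hj z κ t ht
  have hD : DifferentiableAt ℂ F t := hFa.differentiableAt
  -- the derivative of `F` along the line `t + τ·(0, X·δ_s)`
  set δ : (S' → 𝔸) × (S → 𝔸) := ((0 : S' → 𝔸), (Pi.single s X : S → 𝔸)) with hδ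
  have hline : HasDerivAt (fun τ : ℂ => t + τ • δ) δ 0 := by
    simpa using ((hasDerivAt_id (0 : ℂ)).smul_const δ).const_add t
  have hD' : HasFDerivAt F (fderiv ℂ F t) (t + (0 : ℂ) • δ) := by rw [zero_smul, add_zero]; exact hD.hasFDerivAt
  have h1 : HasDerivAt (fun τ : ℂ => F (t + τ • δ)) (fderiv ℂ F t δ) 0 := by
    have h := hD'.comp_hasDerivAt (0 : ℂ) hline
    simpa only [Function.comp_def] using h
  -- the sizes of the inserted data: `sup‖ins a′‖ ≤ ‖a′‖ ≤ ρ′`-type bounds at the point `t`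
  have hn' : ‖t.1‖ < ρ' := (pi_norm_lt_iff hρ').2 ht.1
  have hn : ‖t.2‖ < ρ := (pi_norm_lt_iff hρ).2 ht.2
  have hB' : ∀ x κ', ‖insCfg S' t.1 x κ'‖ ≤ ρ' := fun x κ' => (norm_insCfg_le S' t.1 x κ').trans hn'.le
  have hB : ∀ x κ', ‖insCfg S t.2 x κ'‖ ≤ ρ := fun x κ' => (norm_insCfg_le S t.2 x κ').trans hn.le
  -- file 5's single-bond line derivative at `(e^{ins a′}U₀, ins a)` in the direction `bump_s X`
  obtain ⟨h2, -⟩ := prop5_cplx_156_uniform L hL hG k U₀ hU₀ hα hα3 hα8 h52 (insCfg S' t.1) hρ'.le hB' hsmall' hc₃' hρ'1 hE hdX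
    (insCfg S t.2) hρ.le hB hsmall hc₃ hβ s.1.1 s.1.2 X hj z κ
  have h2' : HasDerivAt (fun τ : ℂ => logCovIter L (expCfg (insCfg S' t.1) * U₀) (insCfg S t.2 + τ • bump s.1.1 s.1.2 X) j z κ)
      (dCov L (expCfg (insCfg S' t.1) * U₀) (insCfg S t.2) (bump s.1.1 s.1.2 X) j z κ
        + linCovIter L (expCfg (insCfg S' t.1) * U₀) (bump s.1.1 s.1.2 X) j z κ) 0 := h2
  have h2'' : HasDerivAt (fun τ : ℂ => F (t + τ • δ))
      (dCov L (expCfg (insCfg S' t.1) * U₀) (insCfg S t.2) (bump s.1.1 s.1.2 X) j z κ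
        + linCovIter L (expCfg (insCfg S' t.1) * U₀) (bump s.1.1 s.1.2 X) j z κ) 0 := by
    refine h2'.congr_of_eventuallyEq (Filter.Eventually.of_forall fun τ => ?_)
    simp only [hF, hδ, Prod.fst_add, Prod.snd_add, Prod.smul_fst, Prod.smul_snd, smul_zero, add_zero, insCfg_line]
  exact h1.unique h2''

/-! ## §3 Proposition 5 «extended to include analyticity … statements» -/

include hL hG hU₀ hα hα3 hα8 h52 hρ' hρ hsmall' hc₃' hρ'1 hsmall hc₃ hE hdX hβ in
/-- **THE FUNCTIONAL DERIVATIVE (156) OF `Q_j(U′U₀, ηA)` IS AN ANALYTIC FUNCTION OF `(A′, A)`** on the printed polydisc: for every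
`j ≤ k`, every `Lʲ`-bond `c`, every `s ∈ S` and `X ∈ 𝔸`, `(a′, a) ↦ dC_j(ins a; X·δ_s)(c) + LʲηQ_j(e^{ins a′}U₀)(X·δ_s)(c)` (the
derivative of `A ↦ Q_j(e^{A′}U₀, A)(c)` in the direction `X·δ_s`) is analytic on `{∀ b, ‖a′_b‖ < ρ′} × {∀ b, ‖a_b‖ < ρ}` — print's
«Proposition 5 may be extended to include analyticity … statements». [cite: Balaban1985Averaging, Proposition 7 p.43, Prop. 5 (156) p.42] -/
theorem prop5_cplx_156_analyticOnNhd {j : ℕ} (hj : j ≤ k) (z : Site d) (κ : Fin d) (s : S) (X : 𝔸) :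
    AnalyticOnNhd ℂ
      (fun t : (S' → 𝔸) × (S → 𝔸) =>
        dCov L (expCfg (insCfg S' t.1) * U₀) (insCfg S t.2) (bump s.1.1 s.1.2 X) j z κ
          + linCovIter L (expCfg (insCfg S' t.1) * U₀) (bump s.1.1 s.1.2 X) j z κ)
      {t | (∀ s, ‖t.1 s‖ < ρ') ∧ ∀ s, ‖t.2 s‖ < ρ} := by
  intro t ht
  have han := fderiv_apply_logCovIter_cplx_analyticOnNhd S' S L hL hG k U₀ hU₀ hα hα3 hα8 h52 hρ' hρ hsmall' hc₃' hρ'1 hsmall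
    hc₃ hj z κ ((0 : S' → 𝔸), (Pi.single s X : S → 𝔸)) t ht
  refine han.congr ?_
  filter_upwards [(isOpen_polydisc₂ S' S ρ' ρ).mem_nhds ht] with t' ht'
  exact fderiv_logCovIter_cplx_single_eq S' S L hL hG k U₀ hU₀ hα hα3 hα8 h52 hρ' hρ hsmall' hc₃' hρ'1 hsmall hc₃ hE hdX hβ
    hj z κ t' ht' s X

include hL hG hU₀ hα hα3 hα8 h52 hρ' hρ hsmall' hc₃' hρ'1 hsmall hc₃ hE hdX hβ in
/-- **PROPOSITION 5 (156) AT `U′U₀`, ANALYTIC AND UNIFORM ON THE POLYDISC** — «analyticity and uniformity statements» together: on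
`{∀ b, ‖a′_b‖ < ρ′} × {∀ b, ‖a_b‖ < ρ}`, for every `j ≤ k`, `c`, `s ∈ S`, `X`: the partial derivative `∂_{A_s}Q_j(e^{A′}U₀, A)(c)·X` of
the jointly analytic `Q_j` (i) equals the single-bond differential of file 5, (ii) is analytic in `(A′, A)`, and (iii) obeys
`‖∂_{A_s}Q_j(e^{A′}U₀, A)(c)·X‖ ≤ ((1 + ϑ·Lʲ/Lᵏ)·Lʲ + C₃(Lʲ)²ρ)·L^{−jd}·‖X‖` with `ϑ = thetaCplx d L α₀ k ρ′`, `C₃ = C3Cplx d L`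
depending on the RADII only — «uniformly in A′». [cite: Balaban1985Averaging, Proposition 7 p.43, Prop. 5 (156) p.42] -/
theorem prop5_cplx_156_uniform_on_polydisc {j : ℕ} (hj : j ≤ k) (z : Site d) (κ : Fin d) (s : S) (X : 𝔸)
    (t : (S' → 𝔸) × (S → 𝔸)) (ht : (∀ s, ‖t.1 s‖ < ρ') ∧ ∀ s, ‖t.2 s‖ < ρ) :
    fderiv ℂ (fun t : (S' → 𝔸) × (S → 𝔸) => logCovIter L (expCfg (insCfg S' t.1) * U₀) (insCfg S t.2) j z κ) t
          ((0 : S' → 𝔸), (Pi.single s X : S → 𝔸))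
        = dCov L (expCfg (insCfg S' t.1) * U₀) (insCfg S t.2) (bump s.1.1 s.1.2 X) j z κ
          + linCovIter L (expCfg (insCfg S' t.1) * U₀) (bump s.1.1 s.1.2 X) j z κ ∧
      AnalyticAt ℂ
        (fun t : (S' → 𝔸) × (S → 𝔸) =>
          fderiv ℂ (fun t : (S' → 𝔸) × (S → 𝔸) => logCovIter L (expCfg (insCfg S' t.1) * U₀) (insCfg S t.2) j z κ) t
            ((0 : S' → 𝔸), (Pi.single s X : S → 𝔸))) t ∧
      ‖fderiv ℂ (fun t : (S' → 𝔸) × (S → 𝔸) => logCovIter L (expCfg (insCfg S' t.1) * U₀) (insCfg S t.2) j z κ) t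
          ((0 : S' → 𝔸), (Pi.single s X : S → 𝔸))‖
        ≤ ((1 + thetaCplx d L α₀ k ρ' * ((L : ℝ) ^ j * ((L : ℝ) ^ k)⁻¹)) * (L : ℝ) ^ j
            + C3Cplx d L * ((L : ℝ) ^ j) ^ 2 * ρ) * (((L : ℝ) ^ j) ^ d)⁻¹ * ‖X‖ := by
  have heq := fderiv_logCovIter_cplx_single_eq S' S L hL hG k U₀ hU₀ hα hα3 hα8 h52 hρ' hρ hsmall' hc₃' hρ'1 hsmall hc₃ hE hdX
    hβ hj z κ t ht s X
  have han := fderiv_apply_logCovIter_cplx_analyticOnNhd S' S L hL hG k U₀ hU₀ hα hα3 hα8 h52 hρ' hρ hsmall' hc₃' hρ'1 hsmall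
    hc₃ hj z κ ((0 : S' → 𝔸), (Pi.single s X : S → 𝔸)) t ht
  have hn' : ‖t.1‖ < ρ' := (pi_norm_lt_iff hρ').2 ht.1
  have hn : ‖t.2‖ < ρ := (pi_norm_lt_iff hρ).2 ht.2
  have hB' : ∀ x κ', ‖insCfg S' t.1 x κ'‖ ≤ ρ' := fun x κ' => (norm_insCfg_le S' t.1 x κ').trans hn'.le
  have hB : ∀ x κ', ‖insCfg S t.2 x κ'‖ ≤ ρ := fun x κ' => (norm_insCfg_le S t.2 x κ').trans hn.le
  obtain ⟨-, hbd⟩ := prop5_cplx_156_uniform L hL hG k U₀ hU₀ hα hα3 hα8 h52 (insCfg S' t.1) hρ'.le hB' hsmall' hc₃' hρ'1 hE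
    hdX (insCfg S t.2) hρ.le hB hsmall hc₃ hβ s.1.1 s.1.2 X hj z κ
  exact ⟨heq, han, heq ▸ hbd⟩

end Polydisc

end Literature.MathematicalPhysics.QuantumFieldTheory.Balaban1983to89.B7Prop5CplxAnalytic

end
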